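import Summits.Parity.GeneralizedHardyLittlewood.Theorems.LeeYangFibresPrimeCellsRelativeChowlaDefs
import Summits.Parity.GeneralizedHardyLittlewood.Theorems.LeeYangFibresAbsoluteUpgradeSinglesDecayThresholds
import Literature.NumberTheory.Sieve.LinearEquationsInPrimesDimOne
import HarnessLib

/-!
# Route `LeeYangFibres`, crux `PrimeCellsRelative` (stmt-Parity-14112), line `SketchIdeator4`
# (card `sieve-out-to-chowla`): tightness of the parity input — positivity of the forms is load-bearing

The first typing of the line's conjectural input, `LiouvilleTupleMean t` (vocabulary file
`Theorems/LeeYangFibresPrimeCellsRelativeChowlaDefs.lean`), quantified over ALL integer intervals `I ⊆ [−N, N]`.  On an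
interval where the forms of `S` are NEGATIVE the tuple sign `∏_{i∈S} (−1)^{Ω(ψ_i(m).toNat)}` is identically `+1` (a
non-positive value has `toNat = 0` and `Ω(0) = 0`), so the class sums have no cancellation at all: already the modulus
`d = 1` contributes `#I`.  Hence:

* `not_liouvilleTupleMean_two` — **`¬ LiouvilleTupleMean 2`** (witness `Ψ = (−X − 1, −2X − 1)`, `L = 4`, `A = 1`,
  `I = [0, N]`, `S = {0, 1}`, `r ≡ 0`: the `d = 1` term alone is `N + 1 > C N/log N`);
* `not_forall_liouvilleTupleMean` — so the retired first-registration stub `stub_liouvilleTupleMean :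
  ∀ t ≥ 2, LiouvilleTupleMean t` is FALSE (the line lead's own cheap falsifier, 2026-08-16), which is why the line was
  reshaped onto `LiouvilleTupleMeanPos` (every form `≥ 1` on `I` — exactly what the sieve transfer produces).

Nothing here bears on the corrected input `LiouvilleTupleMeanPos`, for which the witness is inadmissible.
-/

noncomputable section

open Finset Filter

namespace Summit.Parity.GeneralizedHardyLittlewood.Cruxes.PrimeCellsRelative.SieveOutToChowla

open Literature.NumberTheory.Sieve
open Summit.Parity.GeneralizedHardyLittlewood.Theorems.AbsoluteUpgrade (eventually_log_ge)

/-- The witness system `Ψ = (−X − 1, −2X − 1)`: two forms, negative on `[0, ∞)`. [folklore] -/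
def negPair : Fin 2 → AffLinForm 1 :=
  ![⟨![-1], -1⟩, ⟨![-2], -1⟩]

/-- Values of the witness forms: `ψ₀(m) = −m − 1`, `ψ₁(m) = −2m − 1`. [folklore] -/
theorem negPair_eval (m : ℤ) :
    (negPair 0).eval (fun _ => m) = -m - 1 ∧ (negPair 1).eval (fun _ => m) = -2 * m - 1 := by
  constructor <;> simp [negPair, AffLinForm.eval] <;> ring

/-- The witness system is non-degenerate (non-zero, non-proportional linear parts). [folklore] -/
theorem isNondegenerateSystem_negPair : IsNondegenerateSystem negPair := by
  refine ⟨fun i => ?_, fun i j hij a b hab => ?_⟩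
  · fin_cases i <;>
      · intro h
        have := congrFun h 0
        simp [negPair] at this
  · have h0 := hab (fun _ => 0)
    have h1 := hab (fun _ => 1)
    fin_cases i <;> fin_cases j <;> simp [negPair, AffLinForm.eval] at hij h0 h1 ⊢ <;> omega

/-- The witness system has size `≤ 4` at every scale `N ≥ 2` (`|−1| + |−2| + 2/N`). [folklore] -/
theorem affLinSize_negPair_le {N : ℕ} (hN : 2 ≤ N) : affLinSize negPair (N : ℝ) ≤ (4 : ℕ) := by
  have hN' : (2 : ℝ) ≤ N := by exact_mod_cast hN
  have hN0 : (0 : ℝ) < N := by linarith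
  have h1 : |(-1 : ℝ) / N| = 1 / N := by
    rw [abs_div, abs_neg, abs_one, abs_of_pos hN0]
  have hinv : 1 / (N : ℝ) ≤ 1 / 2 := one_div_le_one_div_of_le (by norm_num) hN'
  simp only [affLinSize, negPair, Fin.sum_univ_two, Fin.sum_univ_one, Matrix.cons_val_zero, Matrix.cons_val_one,
    Int.cast_neg, Int.cast_one, Int.cast_ofNat, abs_neg, abs_one, Nat.cast_ofNat]
  rw [show |(2 : ℝ)| = 2 by norm_num, h1]
  linarith

/-- On `[0, N]` the tuple sign of the witness system is identically `+1` (both values are negative). [folklore] -/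
theorem tupleSign_negPair_eq_one {m : ℤ} (hm : 0 ≤ m) : tupleSign negPair Finset.univ m = 1 := by
  obtain ⟨h0, h1⟩ := negPair_eval m
  have e0 : ((negPair 0).eval (fun _ => m)).toNat = 0 := by rw [h0]; exact Int.toNat_of_nonpos (by omega)
  have e1 : ((negPair 1).eval (fun _ => m)).toNat = 0 := by rw [h1]; exact Int.toNat_of_nonpos (by omega)
  unfold tupleSign
  rw [Fin.prod_univ_two, e0, e1]
  simp

/-- The `d = 1` class sum of the witness system over `[0, N]` is `N + 1`. [folklore] -/
theorem classSum_negPair_one (N : ℕ) : classSum negPair Finset.univ 0 N 1 0 = (N : ℝ) + 1 := by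
  unfold classSum
  have hfilter : (Finset.Icc (0 : ℤ) N).filter (fun m : ℤ => m ≡ 0 [ZMOD ((1 : ℕ) : ℤ)]) = Finset.Icc (0 : ℤ) N :=
    Finset.filter_true_of_mem fun m _ => by simp [Int.ModEq]
  rw [hfilter]
  calc ∑ m ∈ Finset.Icc (0 : ℤ) N, tupleSign negPair Finset.univ m = ∑ _m ∈ Finset.Icc (0 : ℤ) N, (1 : ℝ) :=
        Finset.sum_congr rfl fun m hm => tupleSign_negPair_eq_one (Finset.mem_Icc.mp hm).1
    _ = (N : ℝ) + 1 := by
        rw [Finset.sum_const, nsmul_eq_mul, mul_one, Int.card_Icc]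
        have : ((N : ℤ) + 1 - 0).toNat = N + 1 := by omega
        rw [this]
        push_cast
        ring

/-- **`¬ LiouvilleTupleMean 2`: positivity of the forms is load-bearing in the parity input.** With `L = 4`, `A = 1`
and the witness system on `I = [0, N]`, `S = {0,1}`, `r ≡ 0`, the squarefree modulus `d = 1` alone contributes
`N + 1` to the left-hand side, against the bound `C N/log N < N + 1` once `log N ≥ C + 1`.  (Registered sub-goal of
stmt-Parity-14112; the line lead's cheap falsifier of the first-registration stub.) [folklore] -/
theorem not_liouvilleTupleMean_two : ¬ LiouvilleTupleMean 2 := by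
  intro h
  obtain ⟨η, hη, C, N₀, hN⟩ := h 4 1
  obtain ⟨N, hNall⟩ := Filter.eventually_atTop.mp ((eventually_ge_atTop N₀).and ((eventually_ge_atTop 2).and
    (eventually_log_ge (C + 1))))
  obtain ⟨hN0, hN2, hlog⟩ := hNall N le_rfl
  have hNr : (2 : ℝ) ≤ N := by exact_mod_cast hN2
  have hNpos : (0 : ℝ) < N := by linarith
  have hI : Finset.Icc (0 : ℤ) N ⊆ Finset.Icc (-(N : ℤ)) N := Finset.Icc_subset_Icc (by omega) le_rfl
  have hS : 2 ≤ (Finset.univ : Finset (Fin 2)).card := by simp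
  have hb := hN N hN0 negPair isNondegenerateSystem_negPair (affLinSize_negPair_le hN2) 0 N hI Finset.univ hS
    (fun _ => 0)
  -- the `d = 1` term alone is `N + 1`
  have h1mem : 1 ∈ (Finset.Icc 1 ⌊(N : ℝ) ^ η⌋₊).filter Squarefree := by
    rw [Finset.mem_filter, Finset.mem_Icc]
    exact ⟨⟨le_rfl, Nat.le_floor (by rw [Nat.cast_one]; exact Real.one_le_rpow (by linarith) hη.le)⟩,
      squarefree_one⟩
  have hlow : (N : ℝ) + 1 ≤ ∑ d ∈ (Finset.Icc 1 ⌊(N : ℝ) ^ η⌋₊).filter Squarefree,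
      |classSum negPair Finset.univ 0 N d ((fun _ : ℕ => (0 : ℤ)) d)| := by
    have hterm : |classSum negPair Finset.univ 0 N 1 ((fun _ : ℕ => (0 : ℤ)) 1)| = (N : ℝ) + 1 := by
      rw [show ((fun _ : ℕ => (0 : ℤ)) 1) = 0 from rfl, classSum_negPair_one, abs_of_nonneg (by positivity)]
    rw [← hterm]
    exact Finset.single_le_sum (f := fun d => |classSum negPair Finset.univ 0 N d ((fun _ : ℕ => (0 : ℤ)) d)|)
      (fun d _ => abs_nonneg _) h1mem
  -- the bound is `< N + 1`
  have hlogpos : 0 < Real.log N := Real.log_pos (by linarith)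
  have hup : C * N / Real.log N ^ (1 : ℝ) < (N : ℝ) + 1 := by
    rw [Real.rpow_one]
    rcases le_or_gt C 0 with hC | hC
    · have : C * N / Real.log N ≤ 0 := div_nonpos_of_nonpos_of_nonneg (mul_nonpos_of_nonpos_of_nonneg hC hNpos.le)
        hlogpos.le
      linarith
    · rw [div_lt_iff₀ hlogpos]
      nlinarith
  linarith

/-- **The retired first-registration stub is false**: `¬ (∀ t ≥ 2, LiouvilleTupleMean t)`. [folklore] -/
theorem not_forall_liouvilleTupleMean : ¬ (∀ t : ℕ, 2 ≤ t → LiouvilleTupleMean t) :=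
  fun h => not_liouvilleTupleMean_two (h 2 le_rfl)

end Summit.Parity.GeneralizedHardyLittlewood.Cruxes.PrimeCellsRelative.SieveOutToChowla

end
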